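import Mathlib.MeasureTheory.Integral.IntegralEqImproper
import Literature.Analysis.FluidPDE.SereginZajaczkowski2007SwirlProofs
import Literature.Analysis.FluidPDE.SereginZajaczkowski2007L42Vorticity
import HarnessLib

/-!
# Seregin–Zajaczkowski 2007, proof of Lemma 4.3: (4.18) from the integrated `L⁴`-energy inequality

G. Seregin, W. Zajaczkowski, *A sufficient condition of regularity for axially symmetric
solutions to the Navier–Stokes equations*, SIAM J. Math. Anal. 39 (2007) 669–685 =
arXiv:math/0702720, §4, proof of Lemma 4.3 (arXiv p. 6). The named fact `SwirlL4EnergyBound`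
(`SereginZajaczkowski2007Swirl.lean`) is the estimate (4.18),
`sup_t ∫_{𝒞̃₁} |β̃|² dx + ∫_{Q̃₁} |∇β̃|² dz ≤ Φ₅(𝒜₂)`, `β̃ = |ϱ V_φ ψ|²`. Its printed proof ends:
"making use of Young's inequality, we derive […] the main inequality
`∂ₜ ∫_{𝒞̃₁} |α̃|⁴ dx + ∫_{𝒞̃₁} |∇_a(|α̃|²)|² dx ≤ c ∫_{𝒞̃₁} |β̃|² dx (∫_{𝒞̃₁} |∇V|² dx + 𝒜₂) + …`.
It, together with the statement of Lemma 4.2 at `q = 4`, implies (4.18)" — i.e. Grönwall's lemma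
with the `L¹`-in-time kernel `∫ |∇V(·, t)|² dx`.

This proofs-only file isolates that LAST step, exactly as the sibling
`SereginZajaczkowski2007L42Vorticity.lean` does for Lemma 4.2 (`offAxisVorticityL2Bound_of`):

* `swirlEnergy ψ V t = ∫_{𝒞̃₁} β̃(t)² dx` and `swirlDissipation ψ V t = ∫_{𝒞̃₁} ‖∇ₓβ̃(t)‖² dx`
  (`ℝ≥0∞`-valued; the two quantities of (4.18));
* `swirlL4EnergyBound_of_energyInequality`: **if** for every cut-off `ψ` of the printed kind
  (`IsSwirlCutoff ψ`) there is a monotone `A : ℝ≥0 → ℝ≥0` such that for the class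
  `IsSmoothAxisymmetricSolutionOn Q̃ V P` with `𝒜₂ ≤ K` the energy `Y = swirlEnergy ψ V` is bounded
  on every `[-(7/4)², T]`, `T < 0`, and the main inequality holds in integrated form,
  `Y(t) + ∫_{-(7/4)²}^{t} D ≤ ∫_{-(7/4)²}^{t} A(K) (1 + ∫_𝒞̃ |∇V(·,s)|² dx)(1 + Y(s)) ds`
  (`D = swirlDissipation ψ V`, kernel `shellGradEnergy`), **then** `SwirlL4EnergyBound` holds, with
  `Φ₅(K) = e^{L} (1 + L)`, `L = A(K) (4 + K)`: `Y(-(7/4)²) = 0` (the cut-off vanishes near the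
  bottom), Grönwall (`lintegral_gronwall_le_of_Icc`) gives `1 + Y ≤ e^{L}` since
  `∫_{-(7/4)²}^{0} ∫_𝒞̃ |∇V|² ≤ 𝒜₂ ≤ K` (`lintegral_shellGradEnergy_le`), the dissipation integral is
  then `≤ L e^{L}` on every `]-(7/4)², t[` and, letting `t ↑ 0`
  (`AECover.lintegral_tendsto_of_countably_generated`), on `]-(7/4)², 0[`; Tonelli identifies
  `∫_{Q̃₁} ‖∇β̃‖² dz` with `∫ D dt` (the integrand is continuous on `Q̃₁`,
  `continuousOn_fderiv_betaTilde`).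

The hypothesis is the content of (4.15)–(4.17), Hölder, Young and Lemma 4.2, to be supplied by the
energy-identity files; nothing is asserted here.

## References

* G. Seregin, W. Zajaczkowski, SIAM J. Math. Anal. 39 (2007) 669–685, arXiv:math/0702720, §4,
  proof of Lemma 4.3: the main inequality before (4.18) and the sentence "It, together with the
  statement of Lemma 4.2 at `q = 4`, implies (4.18)" (arXiv p. 6). [`SereginZajaczkowski2007`]
* J. C. Robinson, J. L. Rodrigo, W. Sadowski, *The three-dimensional Navier–Stokes equations*,
  CUP 2016, Lemma A.25 (Grönwall with an `L¹` kernel; accepted `lintegral_gronwall_le`).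
  [`RobinsonRodrigoSadowski2016`]
-/

noncomputable section

open MeasureTheory Set Function Filter Topology TopologicalSpace Metric WithLp
open scoped NNReal ENNReal ContDiff InnerProductSpace RealInnerProductSpace

namespace Literature.Analysis.FluidPDE

namespace SereginZajaczkowski2007

open SereginSverak2009

/-- Local notation for physical space `ℝ³ = EuclideanSpace ℝ (Fin 3)`. -/
local notation "ℝ³" => EuclideanSpace ℝ (Fin 3)

/-! ### The two quantities of (4.18) -/

/-- The `L⁴`-energy of the proof of Lemma 4.3, `Y(t) = ∫_{𝒞̃₁} |β̃(x,t)|² dx = ∫_{𝒞̃₁} |α̃|⁴ dx`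
(`β̃ = betaTilde ψ V`, `𝒞̃₁ = 𝒞(5/16, 11/4; 7/4)`), in `ℝ≥0∞`.
[cite: SereginZajaczkowski2007, proof of Lemma 4.3, (4.16) and (4.18) (the quantity ∫|β̃|²)] -/
def swirlEnergy (ψ : ℝ × ℝ³ → ℝ) (V : ℝ → ℝ³ → ℝ³) (t : ℝ) : ℝ≥0∞ :=
  ∫⁻ x in shell (5 / 16) (11 / 4) (7 / 4), ‖betaTilde ψ V t x‖ₑ ^ 2

/-- The dissipation of the proof of Lemma 4.3, `D(t) = ∫_{𝒞̃₁} |∇β̃(x,t)|² dx` (norm of the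
spatial Fréchet derivative of the slice `β̃(t, ·)`), in `ℝ≥0∞`.
[cite: SereginZajaczkowski2007, proof of Lemma 4.3, (4.16) and (4.18) (the quantity ∫|∇β̃|²)] -/
def swirlDissipation (ψ : ℝ × ℝ³ → ℝ) (V : ℝ → ℝ³ → ℝ³) (t : ℝ) : ℝ≥0∞ :=
  ∫⁻ x in shell (5 / 16) (11 / 4) (7 / 4), ‖fderiv ℝ (betaTilde ψ V t) x‖ₑ ^ 2

section Tools

variable {ψ : ℝ × ℝ³ → ℝ} {V : ℝ → ℝ³ → ℝ³} {P : ℝ → ℝ³ → ℝ}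

/-- Before the cut-off is switched on, `β̃(t, ·) = 0`. [folklore] -/
theorem betaTilde_eq_zero_of_forall_eq_zero {t : ℝ} (h0 : ∀ x : ℝ³, ψ (t, x) = 0)
    (V : ℝ → ℝ³ → ℝ³) : betaTilde ψ V t = fun _ => 0 := by
  funext x
  simp [betaTilde, alphaTilde, h0 x]

/-- Before the cut-off is switched on, `Y(t) = 0`. [folklore] -/
theorem swirlEnergy_eq_zero_of_forall_eq_zero {t : ℝ} (h0 : ∀ x : ℝ³, ψ (t, x) = 0)
    (V : ℝ → ℝ³ → ℝ³) : swirlEnergy ψ V t = 0 := by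
  unfold swirlEnergy
  simp only [betaTilde_eq_zero_of_forall_eq_zero h0 V, enorm_zero, ne_eq, OfNat.ofNat_ne_zero,
    not_false_eq_true, zero_pow, lintegral_const, zero_mul]

/-- `Y(-(7/4)²) = 0` for a cut-off of the printed kind. [folklore] -/
theorem swirlEnergy_bot_eq_zero (hψ : IsSwirlCutoff ψ) (V : ℝ → ℝ³ → ℝ³) :
    swirlEnergy ψ V (-(7 / 4 : ℝ) ^ 2) = 0 := by
  obtain ⟨t₀, ht₀, h0⟩ := hψ.time_support
  exact swirlEnergy_eq_zero_of_forall_eq_zero (h0 _ ht₀.le) V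

/-! ### Tonelli for the dissipation and the limit `t ↑ 0` -/

/-- The dissipation integrand `(t, x) ↦ ‖∇ₓβ̃(t, x)‖²` is a.e.-measurable on the product of the
restricted measures (it is continuous on `Q̃₁`). [folklore] -/
theorem aemeasurable_dissipationIntegrand (hψ : IsSwirlCutoff ψ)
    (hV : IsSmoothAxisymmetricSolutionOn (shellCylOpens (1 / 4) 3 2 2) V P) :
    AEMeasurable (fun z : ℝ × ℝ³ => ‖fderiv ℝ (betaTilde ψ V z.1) z.2‖ₑ ^ 2)
      ((volume.restrict (Ioo (-(7 / 4 : ℝ) ^ 2) 0)).prod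
        (volume.restrict (shell (5 / 16) (11 / 4) (7 / 4)))) := by
  rw [Measure.prod_restrict, ← Measure.volume_eq_prod, ← shellCyl_eq_prod]
  have hc : ContinuousOn (fun z : ℝ × ℝ³ => fderiv ℝ (betaTilde ψ V z.1) z.2)
      (shellCyl (5 / 16) (11 / 4) (7 / 4) (7 / 4)) :=
    (continuousOn_fderiv_betaTilde hψ.contDiff hV).mono shellCyl_one_subset_tilde'
  exact (hc.aemeasurable (measurableSet_shellCyl _ _ _ _)).enorm.pow_const _

/-- **Tonelli**: `∫_{Q̃₁} ‖∇β̃‖² dz = ∫_{-(7/4)²}^{0} D(t) dt`. [folklore] -/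
theorem setLIntegral_shellCyl_dissipation_eq (hψ : IsSwirlCutoff ψ)
    (hV : IsSmoothAxisymmetricSolutionOn (shellCylOpens (1 / 4) 3 2 2) V P) :
    ∫⁻ z in shellCyl (5 / 16) (11 / 4) (7 / 4) (7 / 4), ‖fderiv ℝ (betaTilde ψ V z.1) z.2‖ₑ ^ 2 =
      ∫⁻ t in Ioo (-(7 / 4 : ℝ) ^ 2) 0, swirlDissipation ψ V t := by
  rw [shellCyl_eq_prod, Measure.volume_eq_prod, ← Measure.prod_restrict]
  exact lintegral_prod _ (aemeasurable_dissipationIntegrand hψ hV)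

/-- The dissipation `t ↦ D(t)` is a.e.-measurable on `]-(7/4)², 0[`. [folklore] -/
theorem aemeasurable_swirlDissipation (hψ : IsSwirlCutoff ψ)
    (hV : IsSmoothAxisymmetricSolutionOn (shellCylOpens (1 / 4) 3 2 2) V P) :
    AEMeasurable (swirlDissipation ψ V) (volume.restrict (Ioo (-(7 / 4 : ℝ) ^ 2) 0)) :=
  (aemeasurable_dissipationIntegrand hψ hV).lintegral_prod_right'

/-- **From `]-(7/4)², t[`, `t < 0`, to `]-(7/4)², 0[`**: a bound for the dissipation integral on
every `]-(7/4)², t[` passes to the limit `t ↑ 0`. [folklore] -/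
theorem setLIntegral_swirlDissipation_le_of_forall (hψ : IsSwirlCutoff ψ)
    (hV : IsSmoothAxisymmetricSolutionOn (shellCylOpens (1 / 4) 3 2 2) V P) {B : ℝ≥0∞}
    (h : ∀ t ∈ Ioo (-(7 / 4 : ℝ) ^ 2) 0, ∫⁻ s in Ioo (-(7 / 4 : ℝ) ^ 2) t, swirlDissipation ψ V s ≤ B) :
    ∫⁻ s in Ioo (-(7 / 4 : ℝ) ^ 2) 0, swirlDissipation ψ V s ≤ B := by
  set a : ℝ := -(7 / 4 : ℝ) ^ 2 with ha_def
  set b : ℕ → ℝ := fun n => -(1 / ((n : ℝ) + 1)) with hb_def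
  have hb : Tendsto b atTop (𝓝 0) := by
    have h1 := (tendsto_one_div_add_atTop_nhds_zero_nat (𝕜 := ℝ)).neg
    rw [neg_zero] at h1
    exact h1
  have hcover : AECover (volume.restrict (Ioo a 0)) atTop fun n => Ioc a (b n) :=
    aecover_Ioo_of_Ioc tendsto_const_nhds hb
  have hlim := hcover.lintegral_tendsto_of_countably_generated
    (aemeasurable_swirlDissipation hψ hV)
  refine le_of_tendsto' hlim fun n => ?_
  have hbn : b n < 0 := by
    have : (0 : ℝ) < 1 / ((n : ℝ) + 1) := by positivity
    simp only [hb_def]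
    linarith
  by_cases han : a < b n
  · have hbn' : b n ∈ Ioo a 0 := ⟨han, hbn⟩
    calc ∫⁻ s in Ioc a (b n), swirlDissipation ψ V s ∂(volume.restrict (Ioo a 0))
        = ∫⁻ s in Ioc a (b n) ∩ Ioo a 0, swirlDissipation ψ V s := by
          rw [Measure.restrict_restrict measurableSet_Ioc]
      _ ≤ ∫⁻ s in Icc a (b n), swirlDissipation ψ V s :=
          lintegral_mono_set (fun s hs => ⟨hs.1.1.le, hs.1.2⟩)
      _ = ∫⁻ s in Ioo a (b n), swirlDissipation ψ V s := by
          rw [← restrict_Ioo_eq_restrict_Icc]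
      _ ≤ B := h (b n) hbn'
  · have hempty : Ioc a (b n) = ∅ := Ioc_eq_empty han
    rw [hempty, Measure.restrict_empty, lintegral_zero_measure]
    exact zero_le

end Tools

/-! ### (4.18) from the integrated energy inequality -/

/-- Monotonicity of the final function `K ↦ e^{L(K)} (1 + L(K))`, `L(K) = A(K) (4 + K)`.
[folklore] -/
theorem monotone_swirlPhi5 {A : ℝ≥0 → ℝ≥0} (hA : Monotone A) :
    Monotone fun K : ℝ≥0 =>
      Real.toNNReal (Real.exp ((A K * (4 + K) : ℝ≥0) : ℝ)) * (1 + A K * (4 + K)) := by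
  intro K K' hKK'
  have h : A K * (4 + K) ≤ A K' * (4 + K') := by gcongr; exact hA hKK'
  dsimp only
  gcongr

/-- **Seregin–Zajaczkowski 2007, (4.18) from the main inequality of the proof of Lemma 4.3, by
Grönwall's lemma** ("It, together with the statement of Lemma 4.2 at `q = 4`, implies (4.18)").
Suppose that for every cut-off `ψ` of the printed kind there is a monotone `A : ℝ≥0 → ℝ≥0` such
that, for the class of Prop. 4.1 with `𝒜₂ ≤ K`, the `L⁴`-energy `Y(t) = ∫_{𝒞̃₁} β̃(t)² dx` is
bounded on each `[-(7/4)², T]`, `T < 0`, and obeys the main inequality in integrated form with the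
dissipation kept,
`Y(t) + ∫_{-(7/4)²}^{t} ∫_{𝒞̃₁} ‖∇β̃‖² ≤ ∫_{-(7/4)²}^{t} A(K)(1 + ∫_𝒞̃ |∇V(·,s)|² dx)(1 + Y(s)) ds`
for `-(7/4)² < t < 0`. Then (4.18), i.e. the named fact `SwirlL4EnergyBound`, holds with
`Φ₅(K) = e^{L}(1 + L)`, `L = A(K)(4 + K)`: the kernel has integral `≤ L` because
`∫_{-(7/4)²}^{0} ∫_𝒞̃ |∇V|² ≤ ∫_Q̃ |∇V|² ≤ 𝒜₂ ≤ K`; Grönwall gives `1 + Y ≤ e^{L}` (`Y = 0` at the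
bottom), whence the dissipation integral is `≤ L e^{L}` on every `]-(7/4)², t[` and in the limit
`t ↑ 0`; Tonelli turns the latter into `∫_{Q̃₁} ‖∇β̃‖² dz`.
[cite: SereginZajaczkowski2007, proof of Lemma 4.3, (4.18)] -/
theorem swirlL4EnergyBound_of_energyInequality
    (h : ∀ ψ : ℝ × ℝ³ → ℝ, IsSwirlCutoff ψ → ∃ A : ℝ≥0 → ℝ≥0, Monotone A ∧
      ∀ (V : ℝ → ℝ³ → ℝ³) (P : ℝ → ℝ³ → ℝ),
        IsSmoothAxisymmetricSolutionOn (shellCylOpens (1 / 4) 3 2 2) V P →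
        ∀ K : ℝ≥0, szEnergy V P (fun t x => fderiv ℝ (V t) x) ≤ K →
          (∀ T ∈ Ioo (-(7 / 4 : ℝ) ^ 2) 0, ∃ M : ℝ≥0,
              ∀ t ∈ Icc (-(7 / 4 : ℝ) ^ 2) T, swirlEnergy ψ V t ≤ M) ∧
          ∀ t ∈ Ioo (-(7 / 4 : ℝ) ^ 2) 0,
            swirlEnergy ψ V t + ∫⁻ s in Ioo (-(7 / 4 : ℝ) ^ 2) t, swirlDissipation ψ V s ≤
              ∫⁻ s in Ioo (-(7 / 4 : ℝ) ^ 2) t,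
                (A K : ℝ≥0∞) * (1 + shellGradEnergy V s) * (1 + swirlEnergy ψ V s)) :
    SwirlL4EnergyBound := by
  intro ψ hψ
  obtain ⟨A, hA, hmain⟩ := h ψ hψ
  refine ⟨fun K => Real.toNNReal (Real.exp ((A K * (4 + K) : ℝ≥0) : ℝ)) * (1 + A K * (4 + K)),
    monotone_swirlPhi5 hA, ?_⟩
  intro V P hV K hK
  obtain ⟨hbdd, hineq⟩ := hmain V P hV K hK
  set a : ℝ := -(7 / 4 : ℝ) ^ 2 with ha_def
  set L : ℝ≥0 := A K * (4 + K) with hL_def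
  set kern : ℝ → ℝ≥0∞ := fun s => (A K : ℝ≥0∞) * (1 + shellGradEnergy V s) with hkern_def
  have ha4 : -(2 : ℝ) ^ 2 < a := by rw [ha_def]; norm_num
  -- (i) the kernel integral: `∫_{a}^{t} A K (1 + ∫_𝒞̃|∇V|²) ≤ A K (4 + K) = L` for `t ≤ 0`
  have hIa : ∀ t ∈ Ioo a 0, ∫⁻ s in Ioo a t, kern s ≤ (L : ℝ≥0∞) := by
    intro t ht
    have hsub : Ioo a t ⊆ Ioo (-(2 : ℝ) ^ 2) 0 := Ioo_subset_Ioo ha4.le ht.2.le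
    have hB : ∫⁻ s in Ioo a t, shellGradEnergy V s ≤ K :=
      (lintegral_mono_set hsub).trans (hV.lintegral_shellGradEnergy_le.trans hK)
    have hvol : volume (Ioo a t) ≤ 4 := by
      rw [Real.volume_Ioo, ← ENNReal.ofReal_ofNat]
      exact ENNReal.ofReal_le_ofReal (by rw [ha_def]; linarith [ht.2])
    calc ∫⁻ s in Ioo a t, kern s
        = (A K : ℝ≥0∞) * ∫⁻ s in Ioo a t, (1 + shellGradEnergy V s) :=
          lintegral_const_mul' _ _ ENNReal.coe_ne_top
      _ = (A K : ℝ≥0∞) * (volume (Ioo a t) + ∫⁻ s in Ioo a t, shellGradEnergy V s) := by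
          rw [lintegral_add_left' aemeasurable_const, setLIntegral_const, one_mul]
      _ ≤ (A K : ℝ≥0∞) * (4 + K) := by gcongr
      _ = (L : ℝ≥0∞) := by rw [hL_def]; push_cast; ring
  have hY0 : swirlEnergy ψ V a = 0 := swirlEnergy_bot_eq_zero hψ V
  -- (ii) Grönwall: `1 + Y(t) ≤ exp L` for `a < t < 0`
  have hG : ∀ t ∈ Ioo a 0, 1 + swirlEnergy ψ V t ≤ ENNReal.ofReal (Real.exp (L : ℝ)) := by
    intro t ht
    obtain ⟨M, hM⟩ := hbdd t ht
    have hmainT : ∀ s ∈ Icc a t, 1 + swirlEnergy ψ V s ≤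
        1 + ∫⁻ r in Ioo a s, kern r * (1 + swirlEnergy ψ V r) := by
      intro s hs
      rcases eq_or_lt_of_le hs.1 with h0 | h0
      · rw [← h0, hY0, add_zero]
        exact le_self_add
      · have hs' : s ∈ Ioo a 0 := ⟨h0, lt_of_le_of_lt hs.2 ht.2⟩
        calc 1 + swirlEnergy ψ V s
            ≤ 1 + (swirlEnergy ψ V s + ∫⁻ r in Ioo a s, swirlDissipation ψ V r) := by
              gcongr
              exact le_self_add
          _ ≤ 1 + ∫⁻ r in Ioo a s, kern r * (1 + swirlEnergy ψ V r) := by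
              gcongr
              exact hineq s hs'
    have hGr := lintegral_gronwall_le_of_Icc (T₀ := a) (T₁ := t)
      (φ := fun s => 1 + swirlEnergy ψ V s) (a := kern) (B := 1) (M := 1 + M)
      ENNReal.one_ne_top (by finiteness) (fun s hs => add_le_add_right (hM s hs) 1)
      (ne_top_of_le_ne_top ENNReal.coe_ne_top (hIa t ht)) hmainT t ⟨ht.1.le, le_rfl⟩
    rw [one_mul] at hGr
    refine hGr.trans (ENNReal.ofReal_le_ofReal (Real.exp_le_exp.2 ?_))
    have h := ENNReal.toReal_mono ENNReal.coe_ne_top (hIa t ht)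
    rwa [ENNReal.coe_toReal] at h
  -- (iii) the dissipation on `]a, t[`: `∫ D ≤ ∫ kern (1 + Y) ≤ L exp L`
  have hD : ∀ t ∈ Ioo a 0, ∫⁻ s in Ioo a t, swirlDissipation ψ V s ≤
      (L : ℝ≥0∞) * ENNReal.ofReal (Real.exp (L : ℝ)) := by
    intro t ht
    calc ∫⁻ s in Ioo a t, swirlDissipation ψ V s
        ≤ swirlEnergy ψ V t + ∫⁻ s in Ioo a t, swirlDissipation ψ V s := le_add_self
      _ ≤ ∫⁻ s in Ioo a t, kern s * (1 + swirlEnergy ψ V s) := hineq t ht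
      _ ≤ ∫⁻ s in Ioo a t, kern s * ENNReal.ofReal (Real.exp (L : ℝ)) := by
          refine setLIntegral_mono' measurableSet_Ioo fun s hs => ?_
          gcongr
          exact hG s ⟨hs.1, lt_trans hs.2 ht.2⟩
      _ = (∫⁻ s in Ioo a t, kern s) * ENNReal.ofReal (Real.exp (L : ℝ)) :=
          lintegral_mul_const' _ _ ENNReal.ofReal_ne_top
      _ ≤ (L : ℝ≥0∞) * ENNReal.ofReal (Real.exp (L : ℝ)) := by
          gcongr
          exact hIa t ht
  have hD0 : ∫⁻ s in Ioo a 0, swirlDissipation ψ V s ≤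
      (L : ℝ≥0∞) * ENNReal.ofReal (Real.exp (L : ℝ)) :=
    setLIntegral_swirlDissipation_le_of_forall hψ hV hD
  -- (iv) assembling
  have hsup : (⨆ t ∈ Ioo (-(7 / 4 : ℝ) ^ 2) 0,
      ∫⁻ x in shell (5 / 16) (11 / 4) (7 / 4), ‖betaTilde ψ V t x‖ₑ ^ 2) ≤
      ENNReal.ofReal (Real.exp (L : ℝ)) := by
    refine iSup₂_le fun t ht => ?_
    exact le_trans le_add_self (hG t ht)
  have hexp : ENNReal.ofReal (Real.exp (L : ℝ)) =
      ((Real.toNNReal (Real.exp ((A K * (4 + K) : ℝ≥0) : ℝ)) : ℝ≥0) : ℝ≥0∞) := by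
    rw [hL_def]
    rfl
  calc (⨆ t ∈ Ioo (-(7 / 4 : ℝ) ^ 2) 0,
          ∫⁻ x in shell (5 / 16) (11 / 4) (7 / 4), ‖betaTilde ψ V t x‖ₑ ^ 2) +
        ∫⁻ z in shellCyl (5 / 16) (11 / 4) (7 / 4) (7 / 4),
          ‖fderiv ℝ (betaTilde ψ V z.1) z.2‖ₑ ^ 2
      ≤ ENNReal.ofReal (Real.exp (L : ℝ)) + (L : ℝ≥0∞) * ENNReal.ofReal (Real.exp (L : ℝ)) := by
        rw [setLIntegral_shellCyl_dissipation_eq hψ hV]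
        exact add_le_add hsup hD0
    _ = ENNReal.ofReal (Real.exp (L : ℝ)) * (1 + (L : ℝ≥0∞)) := by ring
    _ = ((Real.toNNReal (Real.exp ((A K * (4 + K) : ℝ≥0) : ℝ)) * (1 + A K * (4 + K)) : ℝ≥0) :
          ℝ≥0∞) := by
        rw [hexp, hL_def, ENNReal.coe_mul]
        push_cast
        ring

end SereginZajaczkowski2007

end Literature.Analysis.FluidPDE
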